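import Summits.ValiantsHypothesis.ValiantsHypothesis.Theorems.PolyaContinuedLaplaceRigiditySingKCoreBinomial

/-!
# Top-dimensional components of `Sing(per₄)` with exactly one zero line, part 5: the two K-core stubs
# of stub B-row (line `component_rigidity`, workfile v6: `stub_kcore_noVar`, `stub_kcore_noBinomial`)

Helper file for crux `CoverDecancellation` (stmt-ValiantsHypothesis-17819), line `laplace_rigidity`,
rung row R3 at width 4 (`str₂(per₄) ≥ 5`).  val-idea-10 g3's workfile `Lines/component_rigidity.lean`
(v6) reduces stub B-row (`RowPrimeRigidity`) by sorry-free glue (`rowPrimeRigidity_of_kcore`, types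
(L)/(X) by `…SingTopLines`, the GRADING half `kcore_grading`) to two statements about a prime `P` of
height `≤ 8` over `singPermIdeal ℂ 4` that contains row `i`, no other row and no column (the «K-core»).
This file proves both, with EXACTLY the registered signatures at `F = ℂ` (and over any field with
`2 ≠ 0`, `3 ≠ 0`), by instantiating the generic-point package at the generic point
`x ↦ X_x mod P` of `Frac(ℂ[X]/P)` (`…SingGenericPoint.ker_aeval_quotient_mk_X`):

* **`kcore_noVar`** (= `stub_kcore_noVar`): no variable outside row `i` lies in `P`
  (`…SingKCoreOctic.coord_ne_zero`);
* **`kcore_noBinomial`** (= `stub_kcore_noBinomial`): no binomial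
  `x_{ρc} x_{ρ'c'} − γ · x_{ρc'} x_{ρ'c}` (`ρ ≠ ρ'` off row `i`, `c ≠ c'`, `γ ≠ 0`) lies in `P`
  (`…SingKCoreBinomial.binomial_ne_zero`).

With these the workfile's `stub_rowPrimeRigidity`, `stub_colPrimeRigidity`, `stub_topPrimeRigidity`
close by `exact`; stub C (`stub_twoLineCase_of_topPrimeRigidity`) is separate (port hand, R215 (P3)).
Honest framing: `str₂(per₄) ≥ 5` follows only once C lands; `StrengthTwoPerFour` (stmt-25160, `= 6`),
`CentralLaplaceRigidity`, `CoverDecancellation` and VP ≠ VNP are OPEN and NOT moved; no summit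
statement is touched.  val-width-17819-w1 g2, 2026-08-28.

References: G. Kirkup, *Minimal primes over permanental ideals*, Trans. AMS 360 (2008), Prop. 11 and
Thm. 14 — the CAS facts `J₃ prime`, `(J₃)_{≤2} = 0` in print, here replaced by generic-point
transcendence counts [Kirkup2005].
-/

set_option linter.dupNamespace false

noncomputable section

namespace Summit.ValiantsHypothesis.ValiantsHypothesis.Theorems.PolyaContinuedLaplaceRigidity.SingCodim

open MvPolynomial
open Literature.Computability.AlgebraicComplexity
open Literature.Computability.AlgebraicComplexity.BoraleviCarliniMichalekVentura2025

/-- Given three distinct indices of `Fin 4`, the fourth. -/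
theorem exists_fourth (i ρ ρ' : Fin 4) (h₁ : ρ ≠ i) (h₂ : ρ' ≠ i) (h₃ : ρ ≠ ρ') :
    ∃ l : Fin 4, i ≠ l ∧ ρ ≠ l ∧ ρ' ≠ l := by
  revert i ρ ρ' h₁ h₂ h₃; decide

/-- **K-core, no variable** (general field, `2 ≠ 0`, `3 ≠ 0`): a prime `P ⊇ subpermIdeal F 4 4 3` of
height `≤ 8` containing row `i`, no other row and no column contains no variable outside row `i`.
[cite: Kirkup2005, Thm. 14] -/
theorem kcore_noVar_field {F : Type*} [Field F] (h2 : (2 : F) ≠ 0) (h3 : (3 : F) ≠ 0)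
    (P : Ideal (MvPolynomial (Fin 4 × Fin 4) F)) [P.IsPrime]
    (hle : subpermIdeal F 4 4 3 ≤ P) (h8 : P.height ≤ 8) (i : Fin 4)
    (hrow : ∀ j : Fin 4, (X (i, j) : MvPolynomial (Fin 4 × Fin 4) F) ∈ P)
    (hnorow : ∀ i' : Fin 4, i' ≠ i → ∃ j : Fin 4, (X (i', j) : MvPolynomial (Fin 4 × Fin 4) F) ∉ P)
    (hnocol : ∀ c : Fin 4, ∃ r : Fin 4, (X (r, c) : MvPolynomial (Fin 4 × Fin 4) F) ∉ P) :
    ∀ e : Fin 4 × Fin 4, e.1 ≠ i → (X e : MvPolynomial (Fin 4 × Fin 4) F) ∉ P := by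
  classical
  rintro ⟨j, c⟩ hji hX
  simp only at hji
  obtain ⟨k, l, hkl, hki, hkj, hli, hlj⟩ := exists_two_others i j (Ne.symm hji)
  -- the generic point
  set z : Fin 4 × Fin 4 → FractionRing (MvPolynomial (Fin 4 × Fin 4) F ⧸ P) := fun x =>
    algebraMap (MvPolynomial (Fin 4 × Fin 4) F ⧸ P) (FractionRing (MvPolynomial (Fin 4 × Fin 4) F ⧸ P))
      (Ideal.Quotient.mk P (X x)) with hz
  have hker : RingHom.ker (aeval (R := F) z) = P := ker_aeval_quotient_mk_X P
  have hne := coord_ne_zero h2 h3 hle h8 (Ne.symm hji) hki.symm hli.symm hkj.symm hlj.symm hkl hrow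
    (hnorow j hji) (hnorow k hki) (hnorow l hli) hnocol z hker c
  exact hne ((X_mem_iff_eq_zero z hker (j, c)).1 hX)

/-- **K-core, no binomial** (general field, `2 ≠ 0`, `3 ≠ 0`): the same prime contains no binomial
`x_{ρc} x_{ρ'c'} − γ · x_{ρc'} x_{ρ'c}` with `ρ ≠ ρ'` off row `i`, `c ≠ c'`, `γ ≠ 0`.
[cite: Kirkup2005, Thm. 14] -/
theorem kcore_noBinomial_field {F : Type*} [Field F] (h2 : (2 : F) ≠ 0) (h3 : (3 : F) ≠ 0)
    (P : Ideal (MvPolynomial (Fin 4 × Fin 4) F)) [P.IsPrime]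
    (hle : subpermIdeal F 4 4 3 ≤ P) (h8 : P.height ≤ 8) (i : Fin 4)
    (hrow : ∀ j : Fin 4, (X (i, j) : MvPolynomial (Fin 4 × Fin 4) F) ∈ P)
    (hnorow : ∀ i' : Fin 4, i' ≠ i → ∃ j : Fin 4, (X (i', j) : MvPolynomial (Fin 4 × Fin 4) F) ∉ P)
    (hnocol : ∀ c : Fin 4, ∃ r : Fin 4, (X (r, c) : MvPolynomial (Fin 4 × Fin 4) F) ∉ P) :
    ∀ ρ ρ' c c' : Fin 4, ρ ≠ i → ρ' ≠ i → ρ ≠ ρ' → c ≠ c' → ∀ γ : F, γ ≠ 0 →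
      (X (ρ, c) * X (ρ', c') - C γ * (X (ρ, c') * X (ρ', c)) : MvPolynomial (Fin 4 × Fin 4) F) ∉ P := by
  classical
  intro ρ ρ' c c' hρ hρ' hρρ' hcc' γ _hγ hmem
  obtain ⟨l, hil, hρl, hρ'l⟩ := exists_fourth i ρ ρ' hρ hρ' hρρ'
  set z : Fin 4 × Fin 4 → FractionRing (MvPolynomial (Fin 4 × Fin 4) F ⧸ P) := fun x =>
    algebraMap (MvPolynomial (Fin 4 × Fin 4) F ⧸ P) (FractionRing (MvPolynomial (Fin 4 × Fin 4) F ⧸ P))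
      (Ideal.Quotient.mk P (X x)) with hz
  have hker : RingHom.ker (aeval (R := F) z) = P := ker_aeval_quotient_mk_X P
  have hne := binomial_ne_zero h2 h3 hle h8 (Ne.symm hρ) (Ne.symm hρ') hil hρρ' hρl hρ'l hrow
    (hnorow ρ hρ) (hnorow ρ' hρ') (hnorow l hil.symm) hnocol z hker hcc' γ
  apply hne
  have h0 : aeval z (X (ρ, c) * X (ρ', c') - C γ * (X (ρ, c') * X (ρ', c)) :
      MvPolynomial (Fin 4 × Fin 4) F) = 0 := by
    rw [← RingHom.mem_ker, hker]; exact hmem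
  simp only [map_sub, map_mul, aeval_X, aeval_C] at h0
  exact sub_eq_zero.1 h0

/-- **`stub_kcore_noVar` of `Lines/component_rigidity.lean` (v6), verbatim**: a prime `P` of height
`≤ 8` over `singPermIdeal ℂ 4` containing the variables of row `i`, with no other row and no column
inside `P`, contains NO variable outside row `i`. [cite: Kirkup2005, Thm. 14] -/
theorem kcore_noVar (P : Ideal (MvPolynomial (Fin 4 × Fin 4) ℂ)) [P.IsPrime]
    (hle : VonZurGathen.singPermIdeal ℂ 4 ≤ P) (h8 : P.height ≤ 8) (i : Fin 4)
    (hrow : ∀ j : Fin 4, (X (i, j) : MvPolynomial (Fin 4 × Fin 4) ℂ) ∈ P)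
    (hnorow : ∀ i' : Fin 4, i' ≠ i → ∃ j : Fin 4, (X (i', j) : MvPolynomial (Fin 4 × Fin 4) ℂ) ∉ P)
    (hnocol : ∀ c : Fin 4, ∃ r : Fin 4, (X (r, c) : MvPolynomial (Fin 4 × Fin 4) ℂ) ∉ P) :
    ∀ e : Fin 4 × Fin 4, e.1 ≠ i → (X e : MvPolynomial (Fin 4 × Fin 4) ℂ) ∉ P := by
  have hle' : subpermIdeal ℂ 4 4 3 ≤ P := by
    rw [← singPermIdeal_eq_subpermIdeal ℂ (m := 4) (by norm_num)]; exact hle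
  exact kcore_noVar_field (by norm_num) (by norm_num) P hle' h8 i hrow hnorow hnocol

/-- **`stub_kcore_noBinomial` of `Lines/component_rigidity.lean` (v6), verbatim**: the same prime
contains NO binomial `x_{ρc} x_{ρ'c'} − γ · x_{ρc'} x_{ρ'c}` (`ρ, ρ' ≠ i`, `ρ ≠ ρ'`, `c ≠ c'`, `γ ≠ 0`).
[cite: Kirkup2005, Thm. 14] -/
theorem kcore_noBinomial (P : Ideal (MvPolynomial (Fin 4 × Fin 4) ℂ)) [P.IsPrime]
    (hle : VonZurGathen.singPermIdeal ℂ 4 ≤ P) (h8 : P.height ≤ 8) (i : Fin 4)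
    (hrow : ∀ j : Fin 4, (X (i, j) : MvPolynomial (Fin 4 × Fin 4) ℂ) ∈ P)
    (hnorow : ∀ i' : Fin 4, i' ≠ i → ∃ j : Fin 4, (X (i', j) : MvPolynomial (Fin 4 × Fin 4) ℂ) ∉ P)
    (hnocol : ∀ c : Fin 4, ∃ r : Fin 4, (X (r, c) : MvPolynomial (Fin 4 × Fin 4) ℂ) ∉ P) :
    ∀ ρ ρ' c c' : Fin 4, ρ ≠ i → ρ' ≠ i → ρ ≠ ρ' → c ≠ c' → ∀ γ : ℂ, γ ≠ 0 →
      (X (ρ, c) * X (ρ', c') - C γ * (X (ρ, c') * X (ρ', c)) : MvPolynomial (Fin 4 × Fin 4) ℂ) ∉ P := by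
  have hle' : subpermIdeal ℂ 4 4 3 ≤ P := by
    rw [← singPermIdeal_eq_subpermIdeal ℂ (m := 4) (by norm_num)]; exact hle
  exact kcore_noBinomial_field (by norm_num) (by norm_num) P hle' h8 i hrow hnorow hnocol

end Summit.ValiantsHypothesis.ValiantsHypothesis.Theorems.PolyaContinuedLaplaceRigidity.SingCodim

end
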